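import Summits.QuantumFields.YangMills.Theorems.TwistedTraceScaling.Negative.ValleyGeomExponent
import Summits.QuantumFields.YangMills.Theorems.LuscherReductionTwistedTraceScalingValleyGeomOfLinkProx
import HarnessLib

/-!
# Negative lemma R12 (crux `TwistedTraceScaling`, stmt-QuantumFields-20203): the witness SCHEME of the regime `δ⁴ ≲ η`, and lane A's newest typed
# sub-target `ValleyLinkProxAt L (β^{−p}) (β^{−q})` (p584643) is FALSE for every `0 < q ≤ 4p` — at EVERY `L ≥ 1`

Standing disprover `ym-cdisprove-20203-1` (gen 11).  Lane A of S-BASE reduced the geometry sub-target of its C3 skeleton to LINK PROXIMITY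
(`…TwistedTraceScalingValleyGeomOfLinkProx`, p584643): `ValleyLinkProxAt L δ η` := for every `ε > 0`, eventually in `β`, every `U ∈ valleySet L (δ β) (η β)`
is `U = W·(g·V_θ)` with an upper-hemisphere kinetic step `W`, `|vecPart(W_e)_c| ≤ ε·δ(β)` on every link; `valleyGeomAt_of_linkProx` turns it into
`ValleyGeomAt`, and `coarseNoIntruderAt_of_bo_linkProx_pow` feeds it at `(β^{−p}, β^{−q})`; lane A is assembling the proof for `q > 4p` (comb gauge +
almost-commuting `SU(2)`, p585213–p586465).  R11 (`…Negative.ValleyGeomExponent`) showed `¬ ValleyGeomAt` for `q ≤ 4p` at `L ≥ 2`.  This file: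
* ★ `dom_scheme` — the reusable analytic core of the regime «`0 < δ β` and `δ β⁴ ≤ M·η β` frequently»: ANY proximity text that, at the R10 witness
  `twoLinkCfg a_{θ/L} b_{Ls/θ} ∈ valleySet` (`s = √(η/(4#P+1))`, `θ = max(2Lδ, L√s)`), yields the Polyakov-loop obstruction `min(sin Lα, sin Lτ) ≤ A·L·δ β`
  with `A·(4N + 2√N) ≤ 1`, `N = √(M(4#P+1))`, is contradictory (sharper than R11's endgame: `Lτ ≥ Lδ/(2N + √N)`, so `A` may be LARGE when `M` is small —
  this is what the `O(δ)` refutations of `…Negative.ValleyProximityBigO` use);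
* `frobNorm_step_link_sub_le` — a kinetic step with components `≤ t` moves each link by `≤ 2√3·t` in Frobenius norm (lane A's `frobNorm_sub_one_le_of_step`, per link);
* ★ `valleyLinkProx_false (L) [NeZero L] (hδ hη : → 0) (hM : 0 < M) (hdom : ∃ᶠ β, 0 < δ β ∧ δ β⁴ ≤ M·η β) : ¬ ValleyLinkProxAt L δ η` — EVERY `L ≥ 1` (no test
  vectors, no `covCurl`: the link closeness feeds R11's `min_sin_le_of_near_toron` directly, sign branch unused);
* ★ `valleyLinkProx_pow_false (hp : 0 < p) (hq : 0 < q) (hqp : q ≤ 4p) : ¬ ValleyLinkProxAt L (powScale p) (powScale q)` — EVERY `L ≥ 1`; for `L ≥ 2` the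
  closing `example` re-derives it from R11 through lane A's own `valleyGeomAt_of_linkProx` (consistency of the two routes).
So lane A's forthcoming `valleyLinkProxAt_pow (0 < p) (4p < q)` will be SHARP: together, `ValleyLinkProxAt L (β^{−p}) (β^{−q}) ↔ 4p < q` on `0 < p, q`.
MECHANISM: at the witness, `U_e = W_e·(g·V_θ')_e` with `‖W_e − 1‖_F ≤ 2√3·εδ`; the full-period line holonomies of `g·V_θ'` at a site are
`g(0)·diag(θ'_k)^L·g(0)⁻¹` and COMMUTE, telescoping puts them within `2√3·Lεδ` of `a^L = rot(θ | i)`, `b^L = rot(L²s/θ | j)`, and R10's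
`min_le_of_commute_near_axes` gives `sin(L²s/θ) ≤ 4√3·Lεδ`; under `δ⁴ ≤ Mη`, `L²s/θ ≥ Lδ/(2N+√N)` and Jordan's inequality contradicts this at the FIXED
`ε = 1/(8(4N + 2√N + 1))`.
READING for lane A (COARSE-DESIGN §16): identical to R11 — at `q > 4p` the family is `o(δ)`-link-close to the torons `V_{(θ/L,0,0)}` (consistent), at `q ≤ 4p`
it is `≳ δ` away from every gauge-toron linkwise; `L = 1` is no exception for the LINK text (R11's `L ≥ 2` was an artefact of the single-link test vectors).
HONEST FRAMING: fixed-lattice `SU(2)` geometry about a typed sub-target of a stub (S-BASE C3) of a child of the CONDITIONAL reduction route (femto rung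
R2b1); `ValleyLinkProxAt`/`ValleyGeomAt` at `q > 4p`, `ValleyBOAt`, C3/C4 stay OPEN; not `¬TwistedTraceScaling`, not infinite volume, not a gap, not Clay.
Sorry-free, no new definition; axioms ⊆ {propext, Classical.choice, Quot.sound}.
-/

set_option autoImplicit false

noncomputable section

open Filter Topology
open scoped Matrix Quaternion BigOperators
open Literature.MathematicalPhysics.QuantumFieldTheory hiding SU2
open Literature.MathematicalPhysics.QuantumLattice
open Summit.QuantumFields.YangMills.Theorems.FemtoTransferGap
open Summit.QuantumFields.YangMills.Theorems.FemtoTransferGap.PhysL2 (twoLinkCfg)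
open Summit.QuantumFields.YangMills.Theorems.FemtoTransferGap.TwoLattice.Toron (abelianCfg)
open Summit.QuantumFields.YangMills.Theorems.TwistedTraceScaling.Negative.R8
open Summit.QuantumFields.YangMills.Theorems.TwistedTraceScaling.Negative.R10
open Summit.QuantumFields.YangMills.Theorems.TwistedTraceScaling.Negative.R11

namespace Summit.QuantumFields.YangMills.Theorems.TwistedTraceScaling.Negative.R12

/-! ## §1 The witness scheme of the regime `δ⁴ ≲ η` -/

section Scheme

set_option maxHeartbeats 400000 in
/-- ★ **The analytic core of the regime `δ⁴ ≲ η`.**  Let `δ, η → 0` with `0 < δ β` and `δ β⁴ ≤ M·η β` frequently (`M > 0`), `N = √(M(4#P+1))`, and let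
`A` satisfy `A·(4N + 2√N) ≤ 1`.  If beyond some `β₀` every R10 witness `twoLinkCfg a_α b_τ ∈ valleySet L (δ β) (η β)` (`0 < τ`, `Lτ ≤ Lα ≤ π/2`) obeyed
`min(sin Lα, sin Lτ) ≤ A·L·δ β`, we reach a contradiction at `s = √(η β/(4#P+1))`, `θ = max(2Lδ β, L√s)`, `α = θ/L`, `τ = Ls/θ`: there
`δ β ≤ (2N + √N)·τ` and Jordan gives `sin(Lτ) > Lτ/2`. [cite: Luscher1983, §2] -/
theorem dom_scheme (L : ℕ) [NeZero L] {δ η : ℝ → ℝ} (hδ : Tendsto δ atTop (𝓝 0)) (hη : Tendsto η atTop (𝓝 0))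
    {M : ℝ} (hM : 0 < M) (hdom : ∃ᶠ β in atTop, 0 < δ β ∧ δ β ^ 4 ≤ M * η β) (β₀ : ℝ) {A : ℝ}
    (hA : A * (4 * Real.sqrt (M * (4 * (Fintype.card (Plaquette 3 L) : ℝ) + 1)) +
      2 * Real.sqrt (Real.sqrt (M * (4 * (Fintype.card (Plaquette 3 L) : ℝ) + 1)))) ≤ 1)
    (H : ∀ β : ℝ, β₀ ≤ β → 0 < δ β → 0 < η β →
      ∀ (a b : SU2) (α τ : ℝ), su2Quat a = ⟨Real.cos α, Real.sin α, 0, 0⟩ → su2Quat b = ⟨Real.cos τ, 0, Real.sin τ, 0⟩ →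
        twoLinkCfg (L := L) a b ∈ valleySet L (δ β) (η β) → 0 < τ → (L : ℝ) * τ ≤ L * α → (L : ℝ) * α ≤ Real.pi / 2 →
        min (Real.sin (L * α)) (Real.sin (L * τ)) ≤ A * (L * δ β)) : False := by
  have hLnat : 0 < L := Nat.pos_of_ne_zero (NeZero.ne L)
  have hLpos : (0 : ℝ) < L := Nat.cast_pos.2 hLnat
  have hLne : (L : ℝ) ≠ 0 := hLpos.ne'
  have hL1 : (1 : ℝ) ≤ L := by exact_mod_cast hLnat
  have hπ := Real.pi_pos
  set K : ℝ := 4 * (Fintype.card (Plaquette 3 L) : ℝ) with hK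
  have hK0 : 0 ≤ K := by positivity
  have hK1 : 0 < K + 1 := by positivity
  set N : ℝ := Real.sqrt (M * (K + 1)) with hN
  have hN0 : 0 < N := Real.sqrt_pos.2 (by positivity)
  set ν : ℝ := Real.sqrt N with hν
  have hν0 : 0 < ν := Real.sqrt_pos.2 hN0
  have hνν : ν * ν = N := Real.mul_self_sqrt hN0.le
  -- a good `β`: the regime inequality, beyond `β₀`, and `θ(β) < 1`
  have hs_t : Tendsto (fun β => Real.sqrt (η β / (K + 1))) atTop (𝓝 0) := by
    have h := (hη.div_const (K + 1)).sqrt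
    rwa [zero_div, Real.sqrt_zero] at h
  have hθ_t : Tendsto (fun β => max (2 * L * δ β) (L * Real.sqrt (Real.sqrt (η β / (K + 1))))) atTop (𝓝 0) := by
    have h := (hδ.const_mul (2 * (L : ℝ))).max (hs_t.sqrt.const_mul (L : ℝ))
    rwa [Real.sqrt_zero, mul_zero, mul_zero, max_self] at h
  have hθ_e : ∀ᶠ β in atTop, max (2 * L * δ β) (L * Real.sqrt (Real.sqrt (η β / (K + 1)))) < 1 := hθ_t.eventually_lt_const one_pos
  obtain ⟨β, ⟨hδβ, hdomβ⟩, hβ₀, hθβ⟩ := (hdom.and_eventually ((eventually_ge_atTop β₀).and hθ_e)).exists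
  have hηβ : 0 < η β := pos_of_mul_pos_right ((by positivity : 0 < δ β ^ 4).trans_le hdomβ) hM.le
  -- the parameters at this `β`
  set s : ℝ := Real.sqrt (η β / (K + 1)) with hs
  set θ : ℝ := max (2 * L * δ β) (L * Real.sqrt s) with hθ
  have hs0 : 0 < s := Real.sqrt_pos.2 (div_pos hηβ hK1)
  have hss : s ^ 2 = η β / (K + 1) := Real.sq_sqrt (div_pos hηβ hK1).le
  have hrs0 : 0 < Real.sqrt s := Real.sqrt_pos.2 hs0
  have hrss : Real.sqrt s * Real.sqrt s = s := Real.mul_self_sqrt hs0.le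
  have hθ0 : 0 < θ := lt_max_of_lt_right (by positivity)
  have hθ1 : θ ≤ 1 := hθβ.le
  have hθδ : 2 * L * δ β ≤ θ := le_max_left _ _
  have hθs : L * Real.sqrt s ≤ θ := le_max_right _ _
  have hθs2 : (L : ℝ) ^ 2 * s ≤ θ ^ 2 := by
    have h := pow_le_pow_left₀ (by positivity : (0 : ℝ) ≤ L * Real.sqrt s) hθs 2
    rwa [mul_pow, Real.sq_sqrt hs0.le] at h
  have hθle : θ ≤ 2 * L * δ β + L * Real.sqrt s :=
    max_le (by linarith only [mul_nonneg hLpos.le (Real.sqrt_nonneg s)]) (by linarith only [mul_pos hLpos hδβ])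
  have hθπ : θ ≤ Real.pi / 2 := by linarith only [hθ1, Real.pi_gt_three]
  set α : ℝ := θ / L with hα
  set τ : ℝ := L * s / θ with hτ
  have hα0 : 0 < α := by positivity
  have hLα : (L : ℝ) * α = θ := by rw [hα, mul_div_assoc', mul_div_cancel_left₀ θ hLne]
  have hτ0 : 0 < τ := by positivity
  have hθne : θ ≠ 0 := hθ0.ne'
  have hLτθ : (L : ℝ) * τ * θ = L ^ 2 * s := by rw [hτ, mul_div_assoc', div_mul_cancel₀ _ hθne]; ring
  have hτθ : τ * θ = L * s := by rw [hτ, div_mul_cancel₀ _ hθne]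
  have hLτ : (L : ℝ) * τ ≤ θ := by
    have h : (L : ℝ) * τ * θ ≤ θ * θ := by rw [hLτθ, ← sq]; exact hθs2
    exact le_of_mul_le_mul_right h hθ0
  have hατ : α * τ = s := by
    rw [hα, hτ, div_mul_div_comm, show θ * (L * s) = s * (L * θ) by ring, mul_div_assoc, div_self (mul_pos hLpos hθ0).ne', mul_one]
  have hδα : δ β < α := by
    have h2 : 2 * δ β ≤ α := by rw [hα, le_div_iff₀ hLpos]; linarith only [hθδ]
    linarith only [h2, hδβ]
  -- the action budget
  have hSlt : 4 * (Fintype.card (Plaquette 3 L) : ℝ) * (Real.sin α ^ 2 * Real.sin τ ^ 2) < 2 * η β := by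
    have hαπ : α ≤ Real.pi := by
      have : α ≤ L * α := le_mul_of_one_le_left hα0.le hL1
      linarith only [this, hLα, hθ1, Real.pi_gt_three]
    have hτπ : τ ≤ Real.pi := by
      have : τ ≤ L * τ := le_mul_of_one_le_left hτ0.le hL1
      linarith only [this, hLτ, hθ1, Real.pi_gt_three]
    have h1 : Real.sin α ^ 2 ≤ α ^ 2 := pow_le_pow_left₀ (Real.sin_nonneg_of_nonneg_of_le_pi hα0.le hαπ) (Real.sin_le hα0.le) 2
    have h2 : Real.sin τ ^ 2 ≤ τ ^ 2 := pow_le_pow_left₀ (Real.sin_nonneg_of_nonneg_of_le_pi hτ0.le hτπ) (Real.sin_le hτ0.le) 2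
    have h3 : Real.sin α ^ 2 * Real.sin τ ^ 2 ≤ s ^ 2 := by
      rw [← hατ, mul_pow]; exact mul_le_mul h1 h2 (sq_nonneg _) (sq_nonneg _)
    have h4 : K * s ^ 2 ≤ η β := by
      rw [hss, mul_div_assoc', div_le_iff₀ hK1]; linarith only [hηβ]
    calc 4 * (Fintype.card (Plaquette 3 L) : ℝ) * (Real.sin α ^ 2 * Real.sin τ ^ 2) ≤ K * s ^ 2 := mul_le_mul_of_nonneg_left h3 hK0
      _ ≤ η β := h4
      _ < 2 * η β := by linarith only [hηβ]
  -- the witness, its valley membership, and the obstruction supplied by `H`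
  obtain ⟨a, ha⟩ := exists_su2Quat_eq _ (normSq_axisI α)
  obtain ⟨b, hb⟩ := exists_su2Quat_eq _ (normSq_axisJ τ)
  have hmem : twoLinkCfg (L := L) a b ∈ valleySet L (δ β) (η β) :=
    twoLinkCfg_mem_valleySet ha hb hα0 (by rw [hLα]; exact hθπ) hδα hSlt
  have hkey := H β hβ₀ hδβ hηβ a b α τ ha hb hmem hτ0 (by rw [hLα]; exact hLτ) (by rw [hLα]; exact hθπ)
  have hLτ0 : 0 < (L : ℝ) * τ := by positivity
  have hle : Real.sin (L * τ) ≤ Real.sin (L * α) := by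
    rw [hLα]; exact Real.sin_le_sin_of_le_of_le_pi_div_two (by linarith only [hLτ0, hπ]) hθπ hLτ
  rw [min_eq_right hle] at hkey
  have hjordan : 2 / Real.pi * (L * τ) ≤ Real.sin (L * τ) := Real.mul_le_sin hLτ0.le (hLτ.trans hθπ)
  have hsin : (L : ℝ) * τ / 2 < Real.sin (L * τ) := by
    have hπ4 : Real.pi < 4 := Real.pi_lt_four
    have : (L : ℝ) * τ / 2 < 2 / Real.pi * (L * τ) := by
      rw [div_mul_eq_mul_div, lt_div_iff₀ hπ]; nlinarith only [hLτ0, hπ4]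
    exact this.trans_le hjordan
  -- `δ ≤ ν√s` and `√s ≤ (2ν+1)τ`, hence `δ ≤ (2N + ν)·τ`
  have hsη : Real.sqrt (η β) = Real.sqrt (K + 1) * s := by
    rw [hs, ← Real.sqrt_mul hK1.le, mul_div_assoc', mul_div_cancel_left₀ _ hK1.ne']
  have hδ2 : δ β ^ 2 ≤ N * s := by
    have h1 : δ β ^ 2 = Real.sqrt (δ β ^ 4) := by
      rw [show δ β ^ 4 = (δ β ^ 2) ^ 2 by ring, Real.sqrt_sq (sq_nonneg _)]
    have h2 : Real.sqrt (M * η β) = N * s := by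
      rw [Real.sqrt_mul hM.le, hsη, hN, Real.sqrt_mul hM.le]; ring
    rw [h1, ← h2]
    exact Real.sqrt_le_sqrt hdomβ
  have hδν : δ β ≤ ν * Real.sqrt s := by
    have h : δ β ^ 2 ≤ (ν * Real.sqrt s) ^ 2 := by
      rw [mul_pow, sq ν, sq (Real.sqrt s), hνν, hrss]; exact hδ2
    exact (pow_le_pow_iff_left₀ hδβ.le (by positivity) two_ne_zero).1 h
  have hsτ : Real.sqrt s ≤ (2 * ν + 1) * τ := by
    -- `τ θ = L s` and `θ ≤ 2Lδ + L√s ≤ L(2ν+1)√s`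
    have h1 : θ ≤ L * ((2 * ν + 1) * Real.sqrt s) := by nlinarith only [hθle, hδν, hLpos]
    have h2 : (L : ℝ) * s ≤ τ * (L * ((2 * ν + 1) * Real.sqrt s)) := by
      rw [← hτθ]; exact mul_le_mul_of_nonneg_left h1 hτ0.le
    have h3 : Real.sqrt s * Real.sqrt s ≤ ((2 * ν + 1) * τ) * Real.sqrt s := by
      rw [hrss]; nlinarith only [h2, hLpos]
    exact le_of_mul_le_mul_right h3 hrs0
  have hδτ : δ β ≤ (2 * N + ν) * τ := by
    calc δ β ≤ ν * Real.sqrt s := hδν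
      _ ≤ ν * ((2 * ν + 1) * τ) := mul_le_mul_of_nonneg_left hsτ hν0.le
      _ = (2 * N + ν) * τ := by rw [← hνν]; ring
  -- endgame
  rcases le_or_gt 0 A with hA0 | hA0
  · have h1 : A * (L * δ β) ≤ A * (2 * N + ν) * (L * τ) := by
      have := mul_le_mul_of_nonneg_left hδτ (mul_nonneg hA0 hLpos.le)
      nlinarith only [this]
    have h2 : A * (2 * N + ν) ≤ 1 / 2 := by
      have : A * (4 * N + 2 * ν) ≤ 1 := hA
      linarith only [this]
    have h3 : A * (2 * N + ν) * (L * τ) ≤ 1 / 2 * (L * τ) := mul_le_mul_of_nonneg_right h2 hLτ0.le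
    linarith only [hkey, hsin, h1, h3]
  · have h1 : A * (L * δ β) < 0 := mul_neg_of_neg_of_pos hA0 (by positivity)
    linarith only [hkey, hsin, h1, hLτ0]

end Scheme

/-! ## §2 ★ `ValleyLinkProxAt` is false below the line `q = 4p` — every `L ≥ 1` -/

section LinkProx

variable {L : ℕ}

/-- A kinetic step with components `≤ t` (upper hemisphere) moves each link by `≤ 2√3·t` in Frobenius norm:
`‖(W·V)_e − V_e‖_F = ‖W_e − 1‖_F ≤ 2√3·t`. [folklore] -/
theorem frobNorm_step_link_sub_le (W V : GaugeConfig 3 L SU2) (e : Edge 3 L) (hs : 0 ≤ scalarPart (W e)) {t : ℝ}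
    (hw : ∀ c, |vecPart (W e) c| ≤ t) :
    frobNorm ((((W * V) e : SU2) : Matrix (Fin 2) (Fin 2) ℂ) - ((V e : SU2) : Matrix (Fin 2) (Fin 2) ℂ)) ≤ 2 * Real.sqrt 3 * t := by
  rw [Pi.mul_apply, Submonoid.coe_mul]
  have h : ((W e : SU2) : Matrix (Fin 2) (Fin 2) ℂ) * ((V e : SU2) : Matrix (Fin 2) (Fin 2) ℂ) - ((V e : SU2) : Matrix (Fin 2) (Fin 2) ℂ) =
      (((W e : SU2) : Matrix (Fin 2) (Fin 2) ℂ) - 1) * ((V e : SU2) : Matrix (Fin 2) (Fin 2) ℂ) := by rw [Matrix.sub_mul, Matrix.one_mul]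
  rw [h, frobNorm_mul_unitary _ (su2_mem_unitaryGroup _)]
  exact frobNorm_sub_one_le_of_step hs hw

/-- `√3 ≤ 2`. [folklore] -/
theorem sqrt_three_le_two : Real.sqrt 3 ≤ 2 := by
  rw [show (2 : ℝ) = Real.sqrt (2 ^ 2) by rw [Real.sqrt_sq (by norm_num : (0:ℝ) ≤ 2)]]
  exact Real.sqrt_le_sqrt (by norm_num)

set_option maxHeartbeats 400000 in
/-- ★ **R12. `ValleyLinkProxAt L δ η` is false whenever `δ⁴ ≲ η` frequently — at every `L ≥ 1`.**  For scale functions `δ, η → 0` and `M > 0` with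
`0 < δ β` and `δ β⁴ ≤ M·η β` for arbitrarily large `β`, the LINK-PROXIMITY sub-target fails: the target's decomposition `U = W·(g·V_θ')` of the R10
witness puts every link within `2√3·εδ` of the gauge-toron, whose full-period line holonomies commute, so `sin(L²s/θ) ≤ 4√3·Lεδ`
(`R11.min_sin_le_of_near_toron`, unsigned branch) — contradicting `dom_scheme` at `ε = 1/(8(4N + 2√N + 1))`. [cite: Luscher1983, §2] -/
theorem valleyLinkProx_false (L : ℕ) [NeZero L] {δ η : ℝ → ℝ} (hδ : Tendsto δ atTop (𝓝 0)) (hη : Tendsto η atTop (𝓝 0))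
    {M : ℝ} (hM : 0 < M) (hdom : ∃ᶠ β in atTop, 0 < δ β ∧ δ β ^ 4 ≤ M * η β) : ¬ ValleyLinkProxAt L δ η := by
  intro H
  set N : ℝ := Real.sqrt (M * (4 * (Fintype.card (Plaquette 3 L) : ℝ) + 1)) with hN
  have hN0 : 0 ≤ N := Real.sqrt_nonneg _
  have hν0 : 0 ≤ Real.sqrt N := Real.sqrt_nonneg _
  have hden : 0 < 4 * N + 2 * Real.sqrt N + 1 := by positivity
  set ε : ℝ := 1 / (8 * (4 * N + 2 * Real.sqrt N + 1)) with hε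
  have hε0 : 0 < ε := by positivity
  obtain ⟨β₀, Hβ⟩ := H ε hε0
  refine dom_scheme L hδ hη hM hdom β₀ (A := 4 * Real.sqrt 3 * ε) ?_ ?_
  · have h3 := sqrt_three_le_two
    have h30 : 0 ≤ Real.sqrt 3 := Real.sqrt_nonneg _
    have hε1 : ε * (8 * (4 * N + 2 * Real.sqrt N + 1)) = 1 := by rw [hε]; exact one_div_mul_cancel (by positivity)
    have hX : 0 ≤ 4 * N + 2 * Real.sqrt N := by positivity
    calc 4 * Real.sqrt 3 * ε * (4 * N + 2 * Real.sqrt N) ≤ 4 * 2 * ε * (4 * N + 2 * Real.sqrt N + 1) := by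
          nlinarith only [h3, h30, hε0, hX, mul_nonneg hε0.le hX]
      _ = 1 := by linarith only [hε1]
  · intro β hβ _ _ a b α τ ha hb hmem _ _ _
    obtain ⟨W, g, θ', hUeq, hs, hw⟩ := Hβ β hβ _ hmem
    have hlink : ∀ (y : Site 3 L) (k : Fin 3), k ≠ 2 →
        frobNorm (((twoLinkCfg (L := L) a b (y, k) : SU2) : Matrix (Fin 2) (Fin 2) ℂ) -
            ((gaugeTransform g (abelianCfg L θ') (y, k) : SU2) : Matrix (Fin 2) (Fin 2) ℂ)) ≤ 2 * Real.sqrt 3 * (ε * δ β) ∨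
          frobNorm (((twoLinkCfg (L := L) a b (y, k) : SU2) : Matrix (Fin 2) (Fin 2) ℂ) -
            ((negOne * gaugeTransform g (abelianCfg L θ') (y, k) : SU2) : Matrix (Fin 2) (Fin 2) ℂ)) ≤ 2 * Real.sqrt 3 * (ε * δ β) := by
      intro y k _
      left
      rw [hUeq]
      exact frobNorm_step_link_sub_le W _ (y, k) (hs (y, k)) (hw (y, k))
    calc min (Real.sin (L * α)) (Real.sin (L * τ)) ≤ 2 * (L * (2 * Real.sqrt 3 * (ε * δ β))) := min_sin_le_of_near_toron ha hb g θ' hlink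
      _ = 4 * Real.sqrt 3 * ε * (L * δ β) := by ring

/-- ★ **R12 at lane A's scales: `ValleyLinkProxAt L (β^{−p}) (β^{−q})` is false for `0 < q ≤ 4p`, at every `L ≥ 1`** (`δ⁴ = β^{−4p} ≤ β^{−q} = η`):
the exponent line `q > 4p` of `coarseNoIntruderAt_of_bo_linkProx_pow` is necessary for its LINK-PROXIMITY input. [cite: Luscher1983, §2] -/
theorem valleyLinkProx_pow_false (L : ℕ) [NeZero L] {p q : ℝ} (hp : 0 < p) (hq : 0 < q) (hqp : q ≤ 4 * p) :
    ¬ ValleyLinkProxAt L (powScale p) (powScale q) := by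
  refine valleyLinkProx_false L (tendsto_powScale hp) (tendsto_powScale hq) one_pos
    (Eventually.frequently (Eventually.of_forall fun β => ⟨powScale_pos p β, ?_⟩))
  have hb : 1 ≤ max β 1 := le_max_right _ _
  have hb0 : 0 ≤ max β 1 := zero_le_one.trans hb
  rw [one_mul, powScale, powScale, ← Real.rpow_natCast, ← Real.rpow_mul hb0]
  exact Real.rpow_le_rpow_of_exponent_le hb (by push_cast; linarith)

/-- Consistency of the two routes at `L ≥ 2`: lane A's `valleyGeomAt_of_linkProx` and R11's `valleyGeom_pow_false` give the same conclusion. -/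
example (L : ℕ) [NeZero L] (hL : 2 ≤ L) {p q : ℝ} (hp : 0 < p) (hq : 0 < q) (hqp : q ≤ 4 * p) :
    ¬ ValleyLinkProxAt L (powScale p) (powScale q) := fun h =>
  valleyGeom_pow_false L hL hp hq hqp (valleyGeomAt_of_linkProx h (powScale_pos p) fun β => powScale_le_one hp.le β)

end LinkProx

end Summit.QuantumFields.YangMills.Theorems.TwistedTraceScaling.Negative.R12

end
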